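import Summits.HodgeConjecture.HodgeCM.StubTree.ThetaSpanFromBMM_1

/-! PORT of `HodgeCM/StubTree/ThetaSpanFromBMM.lean` (HodgeCMPerL run 82) — part 2: continuation of `Summits.HodgeConjecture.HodgeCM.StubTree.ThetaSpanFromBMM_1` (split at a top-level declaration boundary by port_pkg.py; scope re-opened below; declarations unchanged). -/

-- port_pkg: scope re-opened for this part (file-level context, then the namespace/section stack open at the cut)
set_option autoImplicit false
noncomputable section
open scoped Matrix
open NumberField NumberField.InfinitePlace
namespace HodgeCM
open Literature.AlgebraicGeometry.Motives (CMType)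
open Literature.AlgebraicGeometry.ShimuraVarieties (conjRingHomK embedding_conjRingHomK)
/-- **PerL Def 3.2 with the forced signs, line `i ∈ {0,1}` prescribed** (KERNEL; slot `0` from slot `1` by
`StubTree.SeesawDatum.swap01`). -/
theorem exists_seesawDatum_of_signs_fix (L : CMField) (P : Fin 4 → InfinitePlace L → Bool)
    (hpair : ∀ w, ({P 0 w, P 1 w} : Multiset Bool) = {P 2 w, P 3 w})
    (i : Fin 4) (hi : i = 0 ∨ i = 1) (e : L) (he : conjRingHomK L e = e)
    (h1 : ∀ τ : L →+* ℂ, ∃ r : ℝ, τ e = r ∧ r ≠ 0 ∧ (0 < r ↔ P i (InfinitePlace.mk τ) = true)) :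
    ∃ D : StubTree.SeesawDatum L, D.a i = e ∧
      ∀ (k : Fin 4) (τ : L →+* ℂ), (0 < (τ (D.a k)).re ↔ P k (InfinitePlace.mk τ) = true) := by
  rcases hi with rfl | rfl
  · let P' : Fin 4 → InfinitePlace L → Bool := ![P 1, P 0, P 2, P 3]
    have hpair' : ∀ w, ({P' 0 w, P' 1 w} : Multiset Bool) = {P' 2 w, P' 3 w} := fun w => by
      show ({P 1 w, P 0 w} : Multiset Bool) = {P 2 w, P 3 w}
      rw [Multiset.pair_comm]; exact hpair w
    have h1' : ∀ τ : L →+* ℂ, ∃ r : ℝ, τ e = r ∧ r ≠ 0 ∧ (0 < r ↔ P' 1 (InfinitePlace.mk τ) = true) := h1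
    obtain ⟨D', hD'e, hD'⟩ := exists_seesawDatum_of_signs_fix1 L P' hpair' e he h1'
    refine ⟨D'.swap01, hD'e, fun k τ => ?_⟩
    fin_cases k
    · exact hD' 1 τ
    · exact hD' 0 τ
    · exact hD' 2 τ
    · exact hD' 3 τ
  · exact exists_seesawDatum_of_signs_fix1 L P hpair e he h1

/-! ## Part B — the typed reduction of (TS) to [BMM16] Cor 7.9 -/

namespace Universe

variable {U : Universe}

/-! ### (X3) MODEL — distinct isotypic pieces are linearly disjoint -/

/-- **MODEL — `U_{(K,Ψ,σ)}(Γ)` meets the sum of the OTHER isotypic pieces trivially.**  In the intended universe a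
non-zero `U.Uiso Γ K Ψ σ` is the CM block `I_{B(Ψ), σ|K₁} ⊆ H^{1,0}(Alb P_Γ)`; distinct blocks are in direct sum
(Poincaré reducibility; `Hom(B,B') = 0` for non-isogenous simple abelian varieties; `H¹(X) = H¹(Alb X)`), and two
triples with the same block give the SAME submodule (excluded by `W ≠ _`).  Class: MODEL. -/
def UisoDisjoint (U : Universe) {L : CMField} {ι₁ : L →+* ℂ} (V : HermSpace3 L ι₁) : Prop :=
  ∀ (Γ : Level V) (K : CMField) (Ψ : CMType K) (σ : K →+* ℂ),
    Disjoint (U.Uiso Γ K Ψ σ)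
      (sSup {W : Submodule ℂ (U.CohC (U.pms L ι₁ V Γ) 1) |
        W ≠ U.Uiso Γ K Ψ σ ∧ ∃ (K' : CMField) (Ψ' : CMType K') (σ' : K' →+* ℂ), W = U.Uiso Γ K' Ψ' σ'})

/-! ### The BMM dictionary datum -/

/-- **The dictionary datum** between the universe's tower `(P_Γ)_Γ` over `(L, ι₁, V)` and [BMM16]'s objects (see the
module docstring for the meaning of each field).  DATA only; its properties are `BMMDict.Standard` (P-IF seams),
`BMMDict.Homogeneous` (P-IF), `BMMDict.ThetaOfLine` (DESIGN), `BMMDict.SignForcing` (THE OBSTRUCTION =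
`BMMDict.TypeMatch` ∧ `BMMDict.SignMatch`, Part C), and the printed `∀ Γ, (BD.X Γ).Cor79`. -/
structure BMMDict (U : Universe) {L : CMField} {ι₁ : L →+* ℂ} (V : HermSpace3 L ι₁) where
  /-- holomorphic theta one-form classes on `P_Γ` from the hermitian line `(L, a x ȳ)` whose splitting characters
  have `L`-type `Φ` -/
  lineTheta : (Γ : Level V) → L → CMType L → Set (U.CohC (U.pms L ι₁ V Γ) 1)
  /-- a neat sublevel -/
  fine : Level V → Level V
  fine_le : ∀ Γ, (fine Γ).Γ ≤ Γ.Γ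
  /-- [BMM16]'s objects at the neat level `fine Γ` -/
  X : Level V → Literature.BMM.BMMSpectrum
  /-- the connected component carrying `P_{fine Γ}` -/
  comp : (Γ : Level V) → (X Γ).Comp
  /-- realisation `H¹(P_{fine Γ}, ℂ) → H•(S, ℂ)` -/
  real : (Γ : Level V) → U.CohC (U.pms L ι₁ V (fine Γ)) 1 →ₗ[ℂ] (X Γ).Coh (comp Γ)
  /-- the bidegree `(a,b)`, `a + b = 1`, with `H^{b×q,a×q}(S) ⊇ H^{1,0}(P_{fine Γ})` -/
  a : ℕ
  b : ℕ

namespace BMMDict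

variable {L : CMField} {ι₁ : L →+* ℂ} {V : HermSpace3 L ι₁} (BD : U.BMMDict V)

/-- all holomorphic theta one-form classes from the line `(L, a x ȳ)` (every splitting type), at level `Γ` -/
def line (Γ : Level V) (a : L) : Set (U.CohC (U.pms L ι₁ V Γ) 1) := ⋃ Φ : CMType L, BD.lineTheta Γ a Φ

/-- (Ported verbatim from the HodgeCMPerL package; no docstring in the source.) -/
theorem mem_line_iff {Γ : Level V} {a : L} {θ : U.CohC (U.pms L ι₁ V Γ) 1} :
    θ ∈ BD.line Γ a ↔ ∃ Φ : CMType L, θ ∈ BD.lineTheta Γ a Φ :=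
  Set.mem_iUnion

/-- (Ported verbatim from the HodgeCMPerL package; no docstring in the source.) -/
theorem mem_line {Γ : Level V} {a : L} {Φ : CMType L} {θ : U.CohC (U.pms L ι₁ V Γ) 1}
    (h : θ ∈ BD.lineTheta Γ a Φ) : θ ∈ BD.line Γ a :=
  Set.mem_iUnion.mpr ⟨Φ, h⟩

/-- all holomorphic theta one-form classes from hermitian lines, at level `Γ` -/
def allTheta (Γ : Level V) : Set (U.CohC (U.pms L ι₁ V Γ) 1) := ⋃ a : L, BD.line Γ a

/-- (Ported verbatim from the HodgeCMPerL package; no docstring in the source.) -/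
theorem mem_allTheta {Γ : Level V} {a : L} {θ : U.CohC (U.pms L ι₁ V Γ) 1} (h : θ ∈ BD.line Γ a) :
    θ ∈ BD.allTheta Γ :=
  Set.mem_iUnion.mpr ⟨a, h⟩

/-- **The dictionary seams** (classes in the module docstring: `m_eq`, `hab`, `line_real` DEF; `real_inj`, `h10_le`,
`theta_sub` P-IF; `descent` MODEL). -/
structure Standard (T : U.ThetaModel) : Prop where
  /-- `m = dim_E V = 3` -/
  m_eq : ∀ Γ, (BD.X Γ).m = 3
  /-- degree one -/
  hab : BD.a + BD.b = 1
  /-- only lines `a ∈ L₀^×` carry theta classes -/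
  line_real : ∀ (Γ : Level V) (a : L), (BD.line Γ a).Nonempty → conjRingHomK L a = a ∧ a ≠ 0
  /-- the realisation is injective … -/
  real_inj : ∀ Γ, Function.Injective (BD.real Γ)
  /-- … and maps `H^{1,0}(P_{fine Γ})` into `H^{b×q,a×q}(S, ℂ)` -/
  h10_le : ∀ Γ, (U.H10 (U.pms L ι₁ V (BD.fine Γ))).map (BD.real Γ) ≤ (BD.X Γ).Hba (BD.comp Γ) BD.b BD.a
  /-- BMM's classes of theta lifts from lines of signature `(a,b)` are realisations of theta one-form classes -/
  theta_sub : ∀ Γ, (BD.X Γ).thetaClasses (BD.comp Γ) BD.a BD.b ⊆ BD.real Γ '' BD.allTheta (BD.fine Γ)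
  /-- descent from the neat level (transfer) -/
  descent : ∀ (Γ : Level V) (ω : U.CohC (U.pms L ι₁ V Γ) 1),
    U.pullC (T.cover Γ (BD.fine Γ) (BD.fine_le Γ)) 1 ω ∈ Submodule.span ℂ (BD.allTheta (BD.fine Γ)) →
      ω ∈ Submodule.span ℂ (BD.allTheta Γ)

/-- **(X1) KERNEL — [BMM16] Cor 7.9 transported through the dictionary: `H^{1,0}(P_Γ)` is spanned by theta one-form
classes from hermitian lines**, at every level `Γ`.  Hypotheses: the functoriality model fact `Fact_pull_hodge`, the
seams, and Cor 7.9 BY NAME for the spectra of the datum. -/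
theorem h10_le_span_allTheta {T : U.ThetaModel} (hH : U.Fact_pull_hodge) (hBD : BD.Standard T)
    (hB : ∀ Γ, (BD.X Γ).Cor79) (Γ : Level V) :
    U.H10 (U.pms L ι₁ V Γ) ≤ Submodule.span ℂ (BD.allTheta Γ) := by
  intro ω hω
  apply hBD.descent Γ ω
  have hω' : U.pullC (T.cover Γ (BD.fine Γ) (BD.fine_le Γ)) 1 ω ∈ U.H10 (U.pms L ι₁ V (BD.fine Γ)) :=
    U.pullC_mem_H10 hH _ hω
  have h1 : BD.real Γ (U.pullC (T.cover Γ (BD.fine Γ) (BD.fine_le Γ)) 1 ω) ∈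
      (BD.X Γ).Hba (BD.comp Γ) BD.b BD.a :=
    hBD.h10_le Γ (Submodule.mem_map_of_mem hω')
  have h2 : BD.real Γ (U.pullC (T.cover Γ (BD.fine Γ) (BD.fine_le Γ)) 1 ω) ∈
      Submodule.span ℂ ((BD.X Γ).thetaClasses (BD.comp Γ) BD.a BD.b) :=
    hB Γ (BD.comp Γ) BD.a BD.b ((BD.X Γ).degreeBound_of_add_eq_one hBD.hab (by rw [hBD.m_eq Γ])) h1
  have h3 : BD.real Γ (U.pullC (T.cover Γ (BD.fine Γ) (BD.fine_le Γ)) 1 ω) ∈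
      (Submodule.span ℂ (BD.allTheta (BD.fine Γ))).map (BD.real Γ) := by
    rw [Submodule.map_span]
    exact Submodule.span_mono (hBD.theta_sub Γ) h2
  obtain ⟨y, hy, hyω⟩ := Submodule.mem_map.mp h3
  rwa [← hBD.real_inj Γ hyω]

/-- **(X2) P-IF — homogeneity**: a holomorphic theta one-form class from ONE line lies in ONE isotypic piece
([Liu21] Thm 4.18: the `ω(μ,ε,χ)`-isotypic part of `H¹_{B,ι₁}(A_K,ℂ)` is `Hom_E(A_K,A_μ)^* α`; readings R1/R2/R4 of
`ThetaModel.Fact_thetaAlbanese`). -/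
def Homogeneous : Prop :=
  ∀ (Γ : Level V) (a : L), ∀ θ ∈ BD.line Γ a,
    ∃ (K' : CMField) (Ψ' : CMType K') (σ' : K' →+* ℂ), θ ∈ U.Uiso Γ K' Ψ' σ'

/-- **(X4a) THE OBSTRUCTION — converse sign-typing.**  If a NON-ZERO holomorphic theta one-form class lifted from
the line `(L, a x ȳ)` lies in the isotypic piece `U_{(K,Ψ,ι₁∘j)}(Γ)`, then at every complex embedding `τ` of `L`
the sign of `a` is the one REQUIRED by `Ψ` (`ThetaModel.reqPos`, PerL Lemma 3.3(a) "the real signs of `W_i` are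
forced", tex ll. 280–284).  Print content and status: module docstring and Part C — it is `TypeMatch ∧ SignMatch`
(`signForcing_of_match`), [Liu21] Thm 4.18/Cor 4.20/Def 4.5 ∘ block rigidity, and the archimedean theta
correspondence (Adams 2007 Prop. 6.6 / Kashiwara–Vergne 1978; [BMM16] §5, §7) = [Liu21] Def 4.12 made exact. -/
def SignForcing (T : U.ThetaModel) : Prop :=
  ∀ (Γ : Level V) (a : L) (θ : U.CohC (U.pms L ι₁ V Γ) 1), θ ∈ BD.line Γ a → θ ≠ 0 →
    ∀ (K : CMField) (Ψ : CMType K) (j : K →+* L), θ ∈ U.Uiso Γ K Ψ (ι₁.comp j) →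
      ∀ τ : L →+* ℂ, T.reqPos K L j ι₁ Ψ τ = decide (0 < (τ a).re)

/-- **(X4b) DESIGN — the model reading of the primitive `T.Theta`**: the slot-`i` theta one-forms of a good context
`c` at level `Γ` include every holomorphic theta one-form class from the `i`-th line `(L, a_i x ȳ)` of `c` that lies
in `U_{Ψ_i}(Γ)`. -/
def ThetaOfLine (T : U.ThetaModel) : Prop :=
  ∀ (c : SeesawCtx L), T.GoodCtx ι₁ c → ∀ (i : Fin 4) (Γ : Level V),
    ∀ θ ∈ BD.line Γ (c.D.a i), θ ∈ U.Uiso Γ c.K (c.Ψ i) c.σ → θ ∈ T.Theta V c i Γ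


/-! ### Part C — THE OBSTRUCTION split into its two printed ingredients: `SignForcing ⇐ TypeMatch ∧ SignMatch` -/

/-- **(X4a-i) P-IF ∘ MODEL — type match** (the CONVERSE TWIN of the tree's `ThetaModel.Fact_thetaAlbanese`).  A
NON-ZERO holomorphic theta one-form class lifted from the line `⟨a⟩` with splitting characters of `L`-type `Φ` that
lies in the isotypic piece `U_{(K,Ψ,ι₁∘j)}(Γ)` satisfies `κ(τ) ∈ Ψ ⟺ τ ∈ Φ` at every complex embedding `τ` of `L`.
PRINT: [Liu21] Thm 4.18 + Cor 4.20 with Def 4.5 (typed `HodgeCM.Literature.Theta.LiuAlbaneseDatum.Thm418_2`,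
`.Cor420`; held chunks p0022 L59–p0023 L55 of `paper:arxiv-2102.11518`): the class lies in `Hom_E(A_K,A_μ)^* α`, and
the `M_μ`-type of `A_μ ⊗_{E,ι₁} ℂ` is the inflation of the reflex type of `(L, Φ_μ) = (L, Φ)` (reading R3(b)/R4 of
`Fact_thetaAlbanese`, GAPS pv04g3-C1/C3, pv14-G1); MODEL: a non-zero vector common to two isotypic pieces makes them
the same block (`UisoDisjoint`), and a block determines its simple CM factor and eigencharacter, whence the
`L`-types read through `κ` agree (CM combinatorics of PerL Lemma 2.1 = kernel `ReflexWelldef`); DESIGN: the meaning of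
`κ` (`Φ(Ψ) = {τ : κ(τ) ∈ Ψ}`, reading R3).  Class: P-IF ∘ MODEL (a READING; no verbatim printed statement). -/
def TypeMatch (T : U.ThetaModel) : Prop :=
  ∀ (Γ : Level V) (a : L) (Φ : CMType L) (θ : U.CohC (U.pms L ι₁ V Γ) 1), θ ∈ BD.lineTheta Γ a Φ → θ ≠ 0 →
    ∀ (K : CMField) (Ψ : CMType K) (j : K →+* L), θ ∈ U.Uiso Γ K Ψ (ι₁.comp j) →
      ∀ τ : L →+* ℂ, T.kappa K L j ι₁ τ ∈ Ψ.1 ↔ τ ∈ Φ.1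

/-- **(X4a-ii) P-IF — sign match** (the archimedean half).  A NON-ZERO holomorphic theta one-form class lifted from
the line `(L, a x ȳ)` with splitting characters of `L`-type `Φ` has, at every complex embedding `τ` of `L`, the sign
`frameSign τ` if `τ ∈ Φ` and the opposite sign if `τ ∉ Φ` (so the sign of `a` at a real place is decided by WHICH
embedding above it belongs to `Φ`).  PRINT: at the compact places, Howe duality for the compact pair `(U(1), U(3))`
in the Fock model — the trivial `U(3)`-type occurs iff the sign of the line matches the member of `Φ_μ` above the
place (Kashiwara–Vergne, Invent. Math. 44 (1978) 1–47; J. Adams, *The theta correspondence over ℝ* (2007) §6,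
Thm 6.3 typed as `CompactDualPairFock.Adams_Thm_6_3` and Prop. 6.6 typed VERBATIM as
`HodgeCM.Literature.UpUmnTheta.Adams_Prop_6_6` (instance `(p; m, n) = (1; 3, 0)` here) in
`HodgeCM/Literature/CohomologicalIsolation.lean` — citable BY NAME once the `lineTheta ↦ UpUmnTheta` dictionary is
typed); at `ι₁`, holomorphic one-form classes are theta lifts from lines of the holomorphic
signature ([BMM16] §5, §7 — the special Schwartz class of bidegree `(bq,aq)` belongs to signature `(a,b)`;
Gelbart–Rogawski, Invent. Math. 105 (1991) §3); globally this is [Liu21] Def 4.12's admissibility clause "`τ'(e)`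
has negative imaginary part for every `τ' ∈ Φ_μ`" (only `μ`-admissible `ε` occur in `H¹`, Prop 4.13) made exact place
by place; DESIGN: the meaning of `frameSign` (`Design_frameSignConj` is its conjugation law).  Class: P-IF. -/
def SignMatch (T : U.ThetaModel) : Prop :=
  ∀ (Γ : Level V) (a : L) (Φ : CMType L) (θ : U.CohC (U.pms L ι₁ V Γ) 1), θ ∈ BD.lineTheta Γ a Φ → θ ≠ 0 →
    ∀ τ : L →+* ℂ,
      (if ind Φ τ = 1 then T.frameSign L ι₁ τ else !(T.frameSign L ι₁ τ)) = decide (0 < (τ a).re)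

omit BD in
/-- (Ported verbatim from the HodgeCMPerL package; no docstring in the source.) -/
theorem ind_eq_one_iff_mem {K : Type} [Field K] (Φ : CMType K) (φ : K →+* ℂ) : ind Φ φ = 1 ↔ φ ∈ Φ.1 := by
  unfold ind
  split_ifs with h
  · simp [h]
  · simp [h]

/-- **(X4a) KERNEL — THE OBSTRUCTION is the conjunction of its two printed ingredients**:
`SignForcing ⇐ TypeMatch ∧ SignMatch` (the required sign `reqPos` is, by definition, the frame sign twisted by
`κ(τ) ∈ Ψ`; `TypeMatch` converts that condition into `τ ∈ Φ`, and `SignMatch` is the sign of the line). -/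
theorem signForcing_of_match {T : U.ThetaModel} (hT : BD.TypeMatch T) (hS : BD.SignMatch T) :
    BD.SignForcing T := by
  classical
  intro Γ a θ hθ hne K Ψ j hU τ
  obtain ⟨Φ, hΦ⟩ := BD.mem_line_iff.mp hθ
  have hiff : ind Ψ (T.kappa K L j ι₁ τ) = 1 ↔ ind Φ τ = 1 := by
    rw [ind_eq_one_iff_mem, ind_eq_one_iff_mem]
    exact hT Γ a Φ θ hΦ hne K Ψ j hU τ
  have hre := hS Γ a Φ θ hΦ hne τ
  unfold ThetaModel.reqPos
  by_cases h : ind Φ τ = 1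
  · rw [if_pos (hiff.mpr h)]
    rwa [if_pos h] at hre
  · rw [if_neg (fun h' => h (hiff.mp h'))]
    rwa [if_neg h] at hre

/-- **(X4c) KERNEL — sorting a theta class into a good context.**  If good contexts for `(K,Ψ,σ)` exist at all, a
non-zero theta class from the line `⟨a⟩` lying in `U_{Ψ_i}(Γ)` (`i = 0,1`) comes from the `i`-th line of SOME good
context `⟨K,Ψ,σ,D⟩` with `D.a i = a`: the signs of `a` are forced (`SignForcing`), and a forced-sign line completes to
a forced-sign seesaw datum (`HodgeCM.exists_seesawDatum_of_signs_fix`). -/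
theorem exists_goodCtx_of_line {T : U.ThetaModel} (hBD : BD.Standard T) (hSF : BD.SignForcing T)
    {K : CMField} {Ψ : Fin 4 → CMType K} {σ : K →+* ℂ}
    (hctx : ∃ D₀ : StubTree.SeesawDatum L, T.GoodCtx ι₁ ⟨K, Ψ, σ, D₀⟩)
    {i : Fin 4} (hi : i = 0 ∨ i = 1) {Γ : Level V} {a : L} {θ : U.CohC (U.pms L ι₁ V Γ) 1}
    (hθ : θ ∈ BD.line Γ a) (hne : θ ≠ 0) (hU : θ ∈ U.Uiso Γ K (Ψ i) σ) :
    ∃ D : StubTree.SeesawDatum L, D.a i = a ∧ T.GoodCtx ι₁ ⟨K, Ψ, σ, D⟩ := by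
  classical
  obtain ⟨D₀, hD₀⟩ := hctx
  obtain ⟨j, hj, hforced⟩ := hD₀.forced
  have hj' : ι₁.comp j = σ := hj
  have hf : ∀ (k : Fin 4) (τ : L →+* ℂ), (0 < (τ (D₀.a k)).re ↔ T.reqPos K L j ι₁ (Ψ k) τ = true) := hforced
  obtain ⟨ha, ha0⟩ := hBD.line_real Γ a ⟨θ, hθ⟩
  have hsign : ∀ τ : L →+* ℂ, T.reqPos K L j ι₁ (Ψ i) τ = decide (0 < (τ a).re) :=
    hSF Γ a θ hθ hne K (Ψ i) j (by rw [hj']; exact hU)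
  -- the required sign is a function of the place (it is realised by the lines of `D₀`)
  let P : Fin 4 → InfinitePlace L → Bool := fun k w => T.reqPos K L j ι₁ (Ψ k) w.embedding
  have hconj : ∀ (k : Fin 4) (τ' : L →+* ℂ),
      T.reqPos K L j ι₁ (Ψ k) (ComplexEmbedding.conjugate τ') = T.reqPos K L j ι₁ (Ψ k) τ' := by
    intro k τ'
    have e1 := hf k τ'
    have e2 := hf k (ComplexEmbedding.conjugate τ')
    rw [ComplexEmbedding.conjugate_coe_eq, Complex.conj_re] at e2
    exact Bool.eq_iff_iff.mpr (e2.symm.trans e1)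
  have hP : ∀ (k : Fin 4) (τ : L →+* ℂ), T.reqPos K L j ι₁ (Ψ k) τ = P k (InfinitePlace.mk τ) := by
    intro k τ
    have hτ : InfinitePlace.mk τ = InfinitePlace.mk (InfinitePlace.mk τ).embedding := by rw [mk_embedding]
    rcases mk_eq_iff.mp hτ with h | h
    · simp only [P]; rw [← h]
    · simp only [P]; rw [← h, hconj]
  -- Lemma 3.3(b): the pair condition at every place
  have hpair : ∀ w : InfinitePlace L, ({P 0 w, P 1 w} : Multiset Bool) = {P 2 w, P 3 w} :=
    fun w => (T.reqPos_pairSum j ι₁ Ψ hD₀.pairSum w.embedding).1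
  -- the prescribed line has the slot-`i` signs
  have h1 : ∀ τ : L →+* ℂ, ∃ r : ℝ, τ a = r ∧ r ≠ 0 ∧ (0 < r ↔ P i (InfinitePlace.mk τ) = true) := by
    intro τ
    have hre : τ a = ((τ a).re : ℂ) := by
      have h := embedding_conjRingHomK L τ a
      rw [ha] at h
      exact (Complex.conj_eq_iff_re.mp h.symm).symm
    refine ⟨(τ a).re, hre, fun h0 => ha0 (RingHom.injective τ ?_), ?_⟩
    · rw [map_zero, hre, h0, Complex.ofReal_zero]
    · have h := hsign τ
      rw [hP i τ] at h
      rw [h, decide_eq_true_iff]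
  obtain ⟨D, hDa, hD⟩ := exists_seesawDatum_of_signs_fix L P hpair i hi a ha h1
  refine ⟨D, hDa, hD₀.pairSum, hD₀.injective, hD₀.mem, j, hj', ?_⟩
  intro k τ
  rw [hP k τ]
  exact hD k τ

end BMMDict

/-! ### (TS) from the package -/

namespace ThetaModel

variable (T : U.ThetaModel) {L : CMField} {ι₁ : L →+* ℂ} (V : HermSpace3 L ι₁)

/-- **KERNEL — one slot of (TS).**  `U_{Ψ_i}(Γ)` (`i = 0,1`) is contained in the span of the slot-`i` theta one-forms
of the good contexts over `(K,Ψ,σ)`.  See the module docstring for the argument (BMM span → isotypic projection →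
sign forcing → completion → `ThetaOfLine`). -/
theorem uiso_le_span_theta (hH : U.Fact_pull_hodge) {BD : U.BMMDict V} (hBD : BD.Standard T)
    (hB : ∀ Γ, (BD.X Γ).Cor79) (hI : U.UisoDisjoint V) (hHom : BD.Homogeneous) (hSF : BD.SignForcing T)
    (hTL : BD.ThetaOfLine T) {K : CMField} {Ψ : Fin 4 → CMType K} {σ : K →+* ℂ}
    (hctx : ∃ D₀ : StubTree.SeesawDatum L, T.GoodCtx ι₁ ⟨K, Ψ, σ, D₀⟩)
    {i : Fin 4} (hi : i = 0 ∨ i = 1) (Γ : Level V) :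
    U.Uiso Γ K (Ψ i) σ ≤ Submodule.span ℂ
      {θ | ∃ Dsee : StubTree.SeesawDatum L,
        T.GoodCtx ι₁ ⟨K, Ψ, σ, Dsee⟩ ∧ θ ∈ T.Theta V ⟨K, Ψ, σ, Dsee⟩ i Γ} := by
  classical
  intro ω hω
  -- every theta class from a line lying in `U_{Ψ_i}` is a slot-`i` theta form of a good context (or zero)
  have key : ∀ θ ∈ BD.allTheta Γ, θ ∈ U.Uiso Γ K (Ψ i) σ → θ ∈ Submodule.span ℂ
      {θ | ∃ Dsee : StubTree.SeesawDatum L,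
        T.GoodCtx ι₁ ⟨K, Ψ, σ, Dsee⟩ ∧ θ ∈ T.Theta V ⟨K, Ψ, σ, Dsee⟩ i Γ} := by
    intro θ hθ hθU
    obtain ⟨a, ha⟩ := Set.mem_iUnion.mp hθ
    by_cases hne : θ = 0
    · rw [hne]; exact Submodule.zero_mem _
    obtain ⟨D, hDa, hD⟩ := BD.exists_goodCtx_of_line hBD hSF hctx hi ha hne hθU
    have ha' : θ ∈ BD.line Γ (D.a i) := by rw [hDa]; exact ha
    exact Submodule.subset_span ⟨D, hD, hTL ⟨K, Ψ, σ, D⟩ hD i Γ θ ha' hθU⟩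
  -- `ω` is a finite combination of theta classes from lines ([BMM16] Cor 7.9 through the dictionary)
  have hωspan : ω ∈ Submodule.span ℂ (BD.allTheta Γ) :=
    BD.h10_le_span_allTheta hH hBD hB Γ (U.Uiso_le_H10 hH Γ K (Ψ i) σ hω)
  obtain ⟨c, t, ht, -, hsum⟩ := Submodule.mem_span_iff_exists_finset_subset.mp hωspan
  -- split the sum along membership in `U_{Ψ_i}`
  have hsplit : (∑ θ ∈ t.filter (fun θ => θ ∈ U.Uiso Γ K (Ψ i) σ), c θ • θ) +
      ∑ θ ∈ t.filter (fun θ => θ ∉ U.Uiso Γ K (Ψ i) σ), c θ • θ = ω := by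
    rw [Finset.sum_filter_add_sum_filter_not]; exact hsum
  have hx₀G : (∑ θ ∈ t.filter (fun θ => θ ∈ U.Uiso Γ K (Ψ i) σ), c θ • θ) ∈ Submodule.span ℂ
      {θ | ∃ Dsee : StubTree.SeesawDatum L,
        T.GoodCtx ι₁ ⟨K, Ψ, σ, Dsee⟩ ∧ θ ∈ T.Theta V ⟨K, Ψ, σ, Dsee⟩ i Γ} := by
    refine Submodule.sum_mem _ fun θ hθ => Submodule.smul_mem _ _ ?_
    obtain ⟨hθt, hθU⟩ := Finset.mem_filter.mp hθ
    exact key θ (ht hθt) hθU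
  have hx₀U : (∑ θ ∈ t.filter (fun θ => θ ∈ U.Uiso Γ K (Ψ i) σ), c θ • θ) ∈ U.Uiso Γ K (Ψ i) σ :=
    Submodule.sum_mem _ fun θ hθ => Submodule.smul_mem _ _ (Finset.mem_filter.mp hθ).2
  -- the remainder lies in the sum of the OTHER pieces (homogeneity) and in `U_{Ψ_i}` (difference): it vanishes
  have hx₁S : (∑ θ ∈ t.filter (fun θ => θ ∉ U.Uiso Γ K (Ψ i) σ), c θ • θ) ∈
      sSup {W : Submodule ℂ (U.CohC (U.pms L ι₁ V Γ) 1) |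
        W ≠ U.Uiso Γ K (Ψ i) σ ∧ ∃ (K' : CMField) (Ψ' : CMType K') (σ' : K' →+* ℂ), W = U.Uiso Γ K' Ψ' σ'} := by
    refine Submodule.sum_mem _ fun θ hθ => Submodule.smul_mem _ _ ?_
    obtain ⟨hθt, hθU⟩ := Finset.mem_filter.mp hθ
    obtain ⟨a, ha⟩ := Set.mem_iUnion.mp (ht hθt)
    obtain ⟨K', Ψ', σ', hmem⟩ := hHom Γ a θ ha
    have hne : U.Uiso Γ K' Ψ' σ' ≠ U.Uiso Γ K (Ψ i) σ := fun h => hθU (h ▸ hmem)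
    exact (le_sSup ⟨hne, K', Ψ', σ', rfl⟩ :
      U.Uiso Γ K' Ψ' σ' ≤ sSup {W : Submodule ℂ (U.CohC (U.pms L ι₁ V Γ) 1) |
        W ≠ U.Uiso Γ K (Ψ i) σ ∧ ∃ (K' : CMField) (Ψ' : CMType K') (σ' : K' →+* ℂ), W = U.Uiso Γ K' Ψ' σ'})
      hmem
  have hx₁U : (∑ θ ∈ t.filter (fun θ => θ ∉ U.Uiso Γ K (Ψ i) σ), c θ • θ) ∈ U.Uiso Γ K (Ψ i) σ := by
    have h : (∑ θ ∈ t.filter (fun θ => θ ∉ U.Uiso Γ K (Ψ i) σ), c θ • θ) =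
        ω - ∑ θ ∈ t.filter (fun θ => θ ∈ U.Uiso Γ K (Ψ i) σ), c θ • θ := by
      rw [← hsplit]; abel
    rw [h]
    exact Submodule.sub_mem _ hω hx₀U
  have hx₁ : (∑ θ ∈ t.filter (fun θ => θ ∉ U.Uiso Γ K (Ψ i) σ), c θ • θ) = 0 :=
    (Submodule.disjoint_def.mp (hI Γ K (Ψ i) σ)) _ hx₁U hx₁S
  rw [← hsplit, hx₁, add_zero]
  exact hx₀G

/-- **THE THEOREM OF THIS FILE — (TS) from [BMM16] Cor 7.9 by name** and the labelled hypotheses of the module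
docstring, for every `(K,Ψ,σ)` admitting a good context. -/
theorem thetaSpan_of_bmm (hH : U.Fact_pull_hodge) {BD : U.BMMDict V} (hBD : BD.Standard T)
    (hB : ∀ Γ, (BD.X Γ).Cor79) (hI : U.UisoDisjoint V) (hHom : BD.Homogeneous) (hSF : BD.SignForcing T)
    (hTL : BD.ThetaOfLine T) {K : CMField} {Ψ : Fin 4 → CMType K} {σ : K →+* ℂ}
    (hctx : ∃ D₀ : StubTree.SeesawDatum L, T.GoodCtx ι₁ ⟨K, Ψ, σ, D₀⟩) : T.ThetaSpan V K Ψ σ := by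
  intro Γ
  exact ⟨T.uiso_le_span_theta V hH hBD hB hI hHom hSF hTL hctx (Or.inl rfl) Γ,
    T.uiso_le_span_theta V hH hBD hB hI hHom hSF hTL hctx (Or.inr rfl) Γ⟩

end ThetaModel

/-! ### Under the face and the PerL binders; the headline theorems -/

variable (U)

/-- **The BMM package, faces**: for every Galois CM field `F` with `[F:ℚ] ≥ 6`, face `f`, admissible `ι₁` and
hermitian space `V` (so `d ≥ 3` and `V` is anisotropic: BMM's setting), the isotypic pieces of the tower are
disjoint [MODEL] and there is a dictionary datum whose seams hold [P-IF], whose spectra satisfy [BMM16] Cor 7.9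
[P, by name], with homogeneity [MODEL], sign forcing [THE OBSTRUCTION] and the design reading of `T.Theta`
[DESIGN].  Never stated as `∀ X : BMMSpectrum, X.Cor79` (junk-false). -/
def BMMFace (T : U.ThetaModel) : Prop :=
  ∀ (F : CMField), IsGalois ℚ F → 6 ≤ Module.finrank ℚ F →
    ∀ (f : Face F) (ι₁ : F →+* ℂ), f.Admissible ι₁ → ∀ V : HermSpace3 F ι₁,
      U.UisoDisjoint V ∧ ∃ BD : U.BMMDict V, BD.Standard T ∧ (∀ Γ, (BD.X Γ).Cor79) ∧
        BD.Homogeneous ∧ BD.SignForcing T ∧ BD.ThetaOfLine T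


-- port_pkg: scope closed for this part
end Universe
end HodgeCM
end
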